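import Summits.Ventures.Crystal3D.StickySpheres.FccChunks
import Summits.Ventures.Crystal3D.LocalLP.ContactBridge
import Mathlib.Analysis.SpecialFunctions.Pow.Asymptotics
import HarnessLib

/-!
# Contacts per particle tend to six: `C(N)/N → 6` (the energetic form of sticky crystallization)

HONEST FRAMING. Part of the venture `Summits/Ventures/Crystal3D` (cell `pub-crystal3d`). This file
PROVES, unconditionally, the venture Prop `ContactsPerParticleTendstoSix` in unfolded form
(`tendsto_maxContacts_div`): the maximal contact number of `N` hard unit spheres in `ℝ³` satisfies
`C(N)/N → 6`, i.e. the sticky-sphere ground-state energy per particle tends to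
`-6 = -(kissing number)/2`. Upper bound: `C(N) ≤ 6N` (kissing number twelve, proved in the tree,
`maxContacts_three_le`). Lower bound: the fcc chunks of `StickySpheres/FccChunks.lean`
(`C(m³) ≥ 6(m-2)³`) with monotonicity give `C(N)/N ≥ 6 - 54 N^{-1/3}` (`maxContacts_div_ge`).
This is the KNOWN "energy half" of sticky crystallization in `ℝ³` (Blanc–Lewin 2015 §2.3);
nothing is claimed about the surface term or about the positions of ground states.
-/

noncomputable section

open scoped BigOperators Topology
open Finset Filter

namespace Summit.Ventures.Crystal3D

/-! ## The limit `C(N)/N → 6` -/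

/-- Integer cube root bracket: every `N` lies in some `[m³, (m+1)³)`. -/
theorem exists_cube_le_lt (N : ℕ) : ∃ m : ℕ, m ^ 3 ≤ N ∧ N < (m + 1) ^ 3 := by
  have hex : ∃ m : ℕ, N < (m + 1) ^ 3 :=
    ⟨N, lt_of_lt_of_le (Nat.lt_succ_self N) (Nat.le_self_pow (by norm_num) _)⟩
  refine ⟨Nat.find hex, ?_, Nat.find_spec hex⟩
  rcases Nat.eq_zero_or_pos (Nat.find hex) with h | h
  · rw [h]; simp
  · have hmin := Nat.find_min hex (Nat.sub_one_lt_of_lt h)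
    rw [Nat.sub_add_cancel h] at hmin
    exact not_lt.1 hmin

/-- The elementary bound `(1 - t)³ ≥ 1 - 3t` for `t ≤ 3` (`(1-t)³ - (1-3t) = t²(3-t)`). -/
theorem one_sub_three_mul_le_cube {t : ℝ} (ht : t ≤ 3) :
    1 - 3 * t ≤ (1 - t) ^ 3 := by
  nlinarith [sq_nonneg t, mul_nonneg (sq_nonneg t) (sub_nonneg.2 ht)]

/-- **Lower bound**: for `N ≥ 1`, `C(N)/N ≥ 6 - 54 · N^{-1/3}`. -/
theorem maxContacts_div_ge (N : ℕ) (hN : 1 ≤ N) :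
    6 - 54 * (N : ℝ) ^ (-(1 : ℝ) / 3) ≤ (maxContacts 3 N : ℝ) / N := by
  obtain ⟨m, hmN, hNm⟩ := exists_cube_le_lt N
  have hNpos : (0 : ℝ) < N := by exact_mod_cast hN
  have hm1 : (0 : ℝ) < (m : ℝ) + 1 := by positivity
  -- `N^{1/3} < m + 1`, hence `54/(m+1) ≤ 54 N^{-1/3}`
  have hroot : (N : ℝ) ^ ((1 : ℝ) / 3) < (m : ℝ) + 1 := by
    have h1 : (N : ℝ) < ((m : ℝ) + 1) ^ 3 := by exact_mod_cast hNm
    have h2 : (((m : ℝ) + 1) ^ 3) ^ ((1 : ℝ) / 3) = (m : ℝ) + 1 := by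
      rw [← Real.rpow_natCast, ← Real.rpow_mul hm1.le]; norm_num
    calc (N : ℝ) ^ ((1 : ℝ) / 3) < (((m : ℝ) + 1) ^ 3) ^ ((1 : ℝ) / 3) :=
          Real.rpow_lt_rpow hNpos.le h1 (by norm_num)
      _ = (m : ℝ) + 1 := h2
  have hrootpos : (0 : ℝ) < (N : ℝ) ^ ((1 : ℝ) / 3) := Real.rpow_pos_of_pos hNpos _
  have hneg : (N : ℝ) ^ (-(1 : ℝ) / 3) = ((N : ℝ) ^ ((1 : ℝ) / 3))⁻¹ := by
    rw [show (-(1 : ℝ) / 3) = -((1 : ℝ) / 3) by ring, Real.rpow_neg hNpos.le]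
  have hinv : 1 / ((m : ℝ) + 1) ≤ (N : ℝ) ^ (-(1 : ℝ) / 3) := by
    rw [hneg, one_div]
    exact inv_anti₀ hrootpos hroot.le
  -- the packing bound
  have hC : (6 * (m - 2) ^ 3 : ℕ) ≤ maxContacts 3 N :=
    (six_mul_cube_le_maxContacts m).trans (maxContacts_mono hmN)
  have hCR : ((6 : ℝ) * ((m : ℝ) - 2) ^ 3 ≤ maxContacts 3 N ∧ 2 ≤ m) ∨ m < 2 := by
    rcases Nat.lt_or_ge m 2 with h | h
    · exact Or.inr h
    · left
      refine ⟨?_, h⟩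
      have : ((6 * (m - 2) ^ 3 : ℕ) : ℝ) = 6 * ((m : ℝ) - 2) ^ 3 := by
        push_cast [Nat.cast_sub h]; ring
      rw [← this]; exact_mod_cast hC
  have hNle : (N : ℝ) ≤ ((m : ℝ) + 1) ^ 3 := by exact_mod_cast hNm.le
  rw [le_div_iff₀ hNpos]
  rcases hCR with ⟨hCR, hm2⟩ | hsmall
  · -- main case `m ≥ 2`
    have ht1 : 3 / ((m : ℝ) + 1) ≤ 3 := by
      rw [div_le_iff₀ hm1]; nlinarith
    have hcube := one_sub_three_mul_le_cube ht1
    -- 6(m-2)^3 = 6 (m+1)^3 (1 - 3/(m+1))^3 ≥ 6 (m+1)^3 (1 - 9/(m+1)) ≥ (6 - 54/(m+1)) N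
    have hkey : (6 - 54 * (1 / ((m : ℝ) + 1))) * N ≤ 6 * ((m : ℝ) - 2) ^ 3 := by
      have e1 : ((m : ℝ) - 2) = ((m : ℝ) + 1) * (1 - 3 / ((m : ℝ) + 1)) := by
        field_simp; ring
      rw [e1, mul_pow]
      have hA : (6 - 54 * (1 / ((m : ℝ) + 1))) * N ≤
          (6 - 54 * (1 / ((m : ℝ) + 1))) * ((m : ℝ) + 1) ^ 3 ∨
          (6 - 54 * (1 / ((m : ℝ) + 1))) < 0 := by
        by_cases hs : 0 ≤ (6 - 54 * (1 / ((m : ℝ) + 1)))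
        · exact Or.inl (mul_le_mul_of_nonneg_left hNle hs)
        · exact Or.inr (not_le.1 hs)
      rcases hA with hA | hneg'
      · refine hA.trans ?_
        have e2 : (6 - 54 * (1 / ((m : ℝ) + 1))) * ((m : ℝ) + 1) ^ 3 =
            6 * ((m : ℝ) + 1) ^ 3 * (1 - 3 * (3 / ((m : ℝ) + 1))) := by
          field_simp; ring
        rw [e2, ← mul_assoc]
        have h6 : (0 : ℝ) ≤ 6 * ((m : ℝ) + 1) ^ 3 := by positivity
        exact mul_le_mul_of_nonneg_left hcube h6
      · -- the left side is negative, the right side non-negative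
        have hr : (0 : ℝ) ≤ ((m : ℝ) + 1) ^ 3 * (1 - 3 / ((m : ℝ) + 1)) ^ 3 := by
          have : (0 : ℝ) ≤ 1 - 3 / ((m : ℝ) + 1) := by
            rw [sub_nonneg, div_le_one hm1]
            have : (2 : ℝ) ≤ m := by exact_mod_cast hm2
            linarith
          positivity
        nlinarith [mul_nonneg hNpos.le (le_of_lt (neg_pos.2 hneg'))]
    calc (6 - 54 * (N : ℝ) ^ (-(1 : ℝ) / 3)) * N ≤ (6 - 54 * (1 / ((m : ℝ) + 1))) * N := by
          apply mul_le_mul_of_nonneg_right _ hNpos.le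
          linarith
      _ ≤ 6 * ((m : ℝ) - 2) ^ 3 := hkey
      _ ≤ maxContacts 3 N := hCR
  · -- `m ≤ 1`: then `N < 8` and the left side is negative
    have hm' : (m : ℝ) + 1 ≤ 2 := by
      have : (m : ℝ) ≤ 1 := by exact_mod_cast Nat.le_of_lt_succ hsmall
      linarith
    have hbig : (27 : ℝ) ≤ 54 * (N : ℝ) ^ (-(1 : ℝ) / 3) := by
      have : (1 : ℝ) / 2 ≤ 1 / ((m : ℝ) + 1) := one_div_le_one_div_of_le hm1 hm'
      linarith
    have h0 : (0 : ℝ) ≤ maxContacts 3 N := Nat.cast_nonneg _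
    nlinarith

/-- **Upper bound**: `C(N)/N ≤ 6`. -/
theorem maxContacts_div_le (N : ℕ) : (maxContacts 3 N : ℝ) / N ≤ 6 := by
  rcases Nat.eq_zero_or_pos N with h | h
  · subst h; simp
  · rw [div_le_iff₀ (by exact_mod_cast h)]
    exact_mod_cast maxContacts_three_le N

/-- **Contacts per particle tend to six**: `C(N)/N → 6` as `N → ∞` — the sticky-sphere
ground-state energy per particle in `ℝ³` tends to `-6`. (The venture Prop
`ContactsPerParticleTendstoSix`, unfolded.) -/
theorem tendsto_maxContacts_div :
    Tendsto (fun N : ℕ => (maxContacts 3 N : ℝ) / N) atTop (𝓝 6) := by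
  -- lower envelope `6 - 54 N^{-1/3} → 6`
  have hlow : Tendsto (fun N : ℕ => (6 : ℝ) - 54 * (N : ℝ) ^ (-(1 : ℝ) / 3)) atTop (𝓝 6) := by
    have h0 : Tendsto (fun N : ℕ => (N : ℝ) ^ (-(1 : ℝ) / 3)) atTop (𝓝 0) := by
      have := (tendsto_rpow_neg_atTop (by norm_num : (0 : ℝ) < 1 / 3)).comp
        tendsto_natCast_atTop_atTop
      refine this.congr fun N => ?_
      simp only [Function.comp_apply]
      congr 1; ring
    have := (h0.const_mul 54).const_sub 6
    simpa using this
  refine tendsto_of_tendsto_of_tendsto_of_le_of_le' hlow tendsto_const_nhds ?_ ?_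
  · filter_upwards [eventually_ge_atTop 1] with N hN
    exact maxContacts_div_ge N hN
  · exact Eventually.of_forall maxContacts_div_le

end Summit.Ventures.Crystal3D

end
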